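import Summits.QuantumFields.BalabanUV.T4Continuum.Support.MinimalActionRefine
import Summits.QuantumFields.BalabanUV.T4Continuum.Support.AveragingDeficitTransport
import Summits.QuantumFields.BalabanUV.T4Continuum.Support.GaugeFieldPerturbation
import Literature.MathematicalPhysics.QuantumFieldTheory.Balaban1983to89.B8Ineq132
import Literature.Analysis.Complex.RungeUnits
import HarnessLib

/-!
# T⁴ programme, node NE3 (η-rate of the minimisers) — THE ACTION SANDWICH, dictionary item S3-D6: BAŁABAN's CLASS (6)
# AS PRINTED (plaquette condition (1.7) AND lattice-current condition (1.9) of B8) versus the tree's `sfClass`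

NE3 formalisation swarm `b2b-balaban-t4-ne3-formalise-*` of the cell `pub-balaban`, unit `b2b-balaban-t4-ne3-formalise-leaf-04`
(LEAF PROVER 04, gen 2), sub-row **S3-D6** of `t4/formal/NE3/LEAVES.md` (typer ρ34∕ρ35; menu item of the row owner
t4-ne3-p1-g18: «type B11's class (6) AS PRINTED incl. the lattice current condition (1.9) and settle the inclusion
`(6)_{ε₀} ⊇ sfClass ε′`», feeding `MinimalActionClassAgnostic`'s binder `hsub`; DIVERGENCE D-s3-1).

WHAT IS PRINTED (renders read as images; NOTHING below is a hypothesis of any theorem — context only).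
[Balaban1985RegularSpaces] (B8), p. 76 (1.1): «(D^{η*}_{U,μ}F)(x) = η⁻¹(R(U(x,x−ηe_μ))F(x−ηe_μ) − F(x))», «R(U)X = UXU⁻¹»;
(1.2): «(D^{η*}_U F)_μ(x) = Σ_{ν<μ} (D^{η*}_{U,ν}F_{νμ})(x) − Σ_{ν>μ} (D^{η*}_{U,ν}F_{μν})(x)»; p. 77 (1.7):
«|U(∂p) − 1| < α₀L^{−2j} for p ∈ Ω_j», (1.9): «|(D^{η*}_U ∂U)(b)| < α₀L^{−2j}(L^jη)^{−1} for b ∈ Ω_j, j = 0, 1, …, k».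
[Balaban1985Variational] (B11), p. 278 (2): the same two conditions with `ε₀` («= ε₀η²(L^jη)^{−2}», «= ε₀η²(L^jη)^{−3}»),
`η = L^{−k}` ((5)), and (6): the variational class `𝔘_k({Ω_j}, ε₀) ∩ 𝔅_k(𝔅_k, V)`.
ALL OF THIS IS ALREADY TYPED IN THE TREE and is imported BY NAME, not re-typed: `B8Ineq132.plaqF` (`U(∂p_{μν}(x))`),
`B8Ineq132.covDeriv η` ((1.1) second line, WITH the printed `η⁻¹`), `B8Ineq132.covDiv η` ((1.2)), `B8Ineq132.CondAt`
((1.7)+(1.9) at one level), `B8Ineq132.InAk L k η α Ω` (= `𝔄_k({Ω_j}, α₀)` = B11's `𝔘_k({Ω_j}, ε₀)`).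

WHAT THIS FILE TYPES AND PROVES (the everywhere-small-field case `Ω_j = T_η` for all `j`, `η = (L^k)⁻¹`):
§1 `ClassSix d L N ε₀ k` := { `U(N)`-valued, `(N·L^k)`-periodic, `InAk L k (L^k)⁻¹ ε₀ (fun _ ↦ univ) U` } — a SET (the
   first factor of (6) on the torus; B11's `𝔅_k(𝔅_k, V)` factor is the tree's `MinimalActionSandwich.admissible`);
   asserted for nothing.  At the binding level `j = k` the two thresholds are BOTH `ε₀/(L^k)²` while `covDiv` carries
   `η⁻¹ = L^k`: the current condition asks the transported DIFFERENCES of adjacent plaquette variables to be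
   `< ε₀/(L^k)³` — ONE POWER finer than the plaquette condition;
§2 generic bookkeeping: (1.7)+(1.9) at the top level give all levels on the torus (`inAk_univ_of_condAt`, print p. 77
   «if these conditions hold for some j = l, then they hold for all j < l»); `‖covDiv η U μ x‖ ≤ |η|⁻¹·(d−1)·t` when every
   transported plaquette difference at the bond is `≤ t` (`norm_covDiv_le`);
§3 `classSix_subset_sfClass` (the class (6) is the SMALLER set);
§4 THE CRUDE ROUTE AND THE k-DEPENDENCE IT FORCES: from `SmallField U a` alone each difference is `≤ 2a`, so
   `U ∈ sfClass ε′ k → U ∈ ClassSix ε₀ k` holds under `2(d−1)·ε′·L^k < ε₀ ∧ ε′ < ε₀` (`mem_classSix_of_sfClass_level`) —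
   `ε′ = O(ε₀L^{−k})`, NO k-uniform `ε′(ε₀, d)`: the menu item's inclusion `(6)_{ε₀} ⊇ sfClass ε′` is NOT available
   k-uniformly (FINDING journal l.10647; independently leaf-09 g2 G-ne3leaf09g2-1 and leaf-05 g3 l.10705, with abelian
   witnesses); (1.9) is a REGULARITY condition, not a smallness condition;
§5 THE k-UNIFORM INCLUSION THAT IS TRUE: for unitary `U` with `SmallField U a`, `a ≤ 1/4`, each transported difference
   is `≤ 2·‖covGrad U (flux U)‖` (`U(∂p) = exp F(p)`, `exp` is 2-Lipschitz on the `½`-ball, unitary transport is an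
   isometry), hence **`mem_classSix_of_regularSup`**: `RegularSup d L N b c k U`, `b ≤ 1/4`, `b < ε₀`, `2(d−1)c < ε₀`
   ⇒ `U ∈ ClassSix d L N ε₀ k` for EVERY `k` with the SAME `ε₀` — met by the sandwich's REFINED competitor (output of
   `SmoothRefine`, which carries `RegularSup`); the AVERAGED competitor `rescale L (bavg L U)` needs a transport of
   the CURRENT under block averaging (B8 Prop. 3 ∕ B7 (128)–(129) TYPE) = the skeleton's located risk (r3), untouched here;
§6 non-vacuity: the flat configuration lies in `ClassSix ε₀ k` for every `ε₀ > 0`.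

HONEST FRAMING.  A dictionary item of finite-T⁴ bookkeeping (rung (B)+1 of the cell's ladder); NOTHING is asserted about
Bałaban's minimisers; printed sentences enter ONLY docstrings and the SHAPE of `ClassSix` (through the tree's `InAk`); no
conditional of the cell (`BetaPertH`, (B), G-an2-4) occurs; **NE3 is NOT proved**; route (A)'s END stays «CONDITIONAL on
(H∃) [B11 Thm 1 TYPE]» over `sfClass`, and over class (6) AS PRINTED additionally on (r3); D-s3-1 is NOT closed — it is
REDUCED to (r3).  Finite T⁴ rung (B)+1; NOT infinite volume, NOT a mass gap, NOT the Clay problem, NOT summit progress.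
ABSOLUTE RULE kept: no printed sentence is a hypothesis; `ClassSix` is a set, not a `Prop` fact; no `sorry`; axioms ⊆
{propext, Classical.choice, Quot.sound}.  PLACEMENT (human rule 2026-08-19): under `Summits/QuantumFields/BalabanUV/`.
HONEST DEPENDENCY: continuum YM on T⁴ ⇐ BetaPertH ∧ nine spine estimates (0/9 proved); BetaPertH ⇐ (D1) ∧ (D4) ∧ CAP+tail;
G-an2-4 gates asym, D1 and NE2/3/4.
-/

set_option autoImplicit false

open scoped BigOperators Matrix Matrix.Norms.L2Operator
open NormedSpace Finset

namespace Summit.QuantumFields.BalabanUV.T4Continuum.MinimalActionClassSix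

open Literature.MathematicalPhysics.QuantumFieldTheory.Balaban1983to89
open B7Prop1Explicit B7Prop2Explicit MatrixLog UnitaryModel
open B7Eq78Linearization (conjR conjR_apply conjR_sub conjR_one)
open B8Ineq132 (plaqF covDeriv covDiv CondAt InAk PlaqTouches BondTouches condAt_mono norm_conjR conjR_conjR one_conjR)
open T4AveragingDeficitWall hiding Site Plane Plaq Bond
open T4AveragingDeficitWallBoundary (IsPeriodicCfg)
open AveragingDeficitTransport (norm_Ad_of_unitary mem_U1_of_unitary)
open GaugeFieldPerturbation (norm_fhol_sub_one_le_of_smallField)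
open MinimalActionRate MinimalActionRefine MinimalActionWitness

noncomputable section

variable {d : ℕ}

/-! ## §1 The class (6) on the torus, as a set of configurations -/

section Defs

variable {n : Type*} [Fintype n] [DecidableEq n]

variable (d) in
/-- **BAŁABAN's CLASS (6), first factor `𝔘_k({Ω_j}, ε₀)`, in the everywhere-small-field case** (`Ω_j = T_η` for all
`j ≤ k`, `η = L^{−k}`): `U(N)`-valued, `(N·L^k)`-periodic configurations (on `ℤ^d`, read on the torus of side `N·L^k`)
lying in the tree's `𝔄_k({T_η}, ε₀)` = `B8Ineq132.InAk` — (1.7) `|U(∂p) − 1| < ε₀L^{−2j}` and (1.9)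
`|(D^{η*}_U ∂U)(b)| < ε₀L^{−2j}(L^jη)^{−1}` for all plaquettes ∕ bonds and all `j ≤ k`, `η = (L^k)⁻¹`.  A SET over which
`MinimalActionClassAgnostic` may read its class family; B11's second factor `𝔅_k(𝔅_k, V)` of (6) is the tree's
`admissible`.  Asserted for no configuration. [cite: Balaban1985Variational, (2), (5), (6) p.278] -/
def ClassSix (L N : ℕ) (ε₀ : ℝ) (k : ℕ) : Set (Site d → Fin d → (Matrix n n ℂ)ˣ) :=
  {U | IsUnitaryCfg U ∧ IsPeriodicCfg U ((N * L ^ k : ℕ) : ℤ) ∧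
    InAk L k (((L : ℝ) ^ k)⁻¹) ε₀ (fun _ => (Set.univ : Set (Site d))) U}

end Defs

/-! ## §2 Generic bookkeeping on `𝔄_k({T_η}, α)` (any complete normed algebra of bond variables) -/

section Generic

variable {𝔸 : Type*} [NormedRing 𝔸] [NormedAlgebra ℂ 𝔸]

omit [NormedAlgebra ℂ 𝔸] in
/-- On the torus every plaquette touches `T_η`. [folklore] -/
theorem plaqTouches_univ (x : Site d) (μ ν : Fin d) : PlaqTouches (Set.univ : Set (Site d)) x μ ν :=
  Or.inl (Set.mem_univ _)

omit [NormedAlgebra ℂ 𝔸] in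
/-- On the torus every bond touches `T_η`. [folklore] -/
theorem bondTouches_univ (x : Site d) (μ : Fin d) : BondTouches (Set.univ : Set (Site d)) x μ :=
  Or.inl (Set.mem_univ _)

/-- (1.7)+(1.9) on `T_η` at the TOP level `k` give them at every level `j ≤ k` («if these conditions hold for some
`j = l`, then they hold for all `j < l`», p. 77): `CondAt k ⇒ InAk k` for the constant family `Ω_j = T_η`.
[cite: Balaban1985RegularSpaces, p.77 (sentence after (1.10))] -/
theorem inAk_univ_of_condAt {L : ℕ} (hL : 1 ≤ L) {k : ℕ} {η α : ℝ} (hη : 0 < η) (hα : 0 ≤ α)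
    {V : Site d → Fin d → 𝔸ˣ} (h : CondAt L η α k (Set.univ : Set (Site d)) V) :
    InAk L k η α (fun _ => (Set.univ : Set (Site d))) V :=
  fun _ hj => condAt_mono hL hα hη hj h

/-- Conversely the top level is one of the levels. [folklore] -/
theorem condAt_of_inAk_univ {L k : ℕ} {η α : ℝ} {V : Site d → Fin d → 𝔸ˣ}
    (h : InAk L k η α (fun _ => (Set.univ : Set (Site d))) V) : CondAt L η α k (Set.univ : Set (Site d)) V :=
  h k le_rfl

/-- The thresholds at the binding level `j = k` with `η = (L^k)⁻¹`: the plaquette threshold `ε₀((L^k)⁻¹)² = ε₀/(L^k)²`.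
[folklore] -/
theorem thr_plaq_eq (L : ℕ) (ε₀ : ℝ) (k : ℕ) : ε₀ * ((((L : ℝ) ^ k)⁻¹) ^ 2) = ε₀ / ((L : ℝ) ^ k) ^ 2 := by
  rw [inv_pow, div_eq_mul_inv]

/-- The current threshold at the binding level: `ε₀((L^k)⁻¹)²·(L^k·(L^k)⁻¹)⁻¹ = ε₀/(L^k)²` (`L ≥ 1`) — the SAME number as
the plaquette threshold, while `covDiv` carries `η⁻¹ = L^k`. [folklore] -/
theorem thr_cur_eq {L : ℕ} (hL : 1 ≤ L) (ε₀ : ℝ) (k : ℕ) :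
    ε₀ * ((((L : ℝ) ^ k)⁻¹) ^ 2) * ((L : ℝ) ^ k * ((L : ℝ) ^ k)⁻¹)⁻¹ = ε₀ / ((L : ℝ) ^ k) ^ 2 := by
  have hL0 : ((L : ℝ) ^ k) ≠ 0 := by positivity
  rw [mul_inv_cancel₀ hL0, inv_one, mul_one, thr_plaq_eq]

/-- (1.7)+(1.9) at the top level from bounds in the tree's `/(L^k)²` currency. [folklore] -/
theorem condAt_top_of_bounds {L : ℕ} (hL : 1 ≤ L) {ε₀ : ℝ} {k : ℕ} {V : Site d → Fin d → 𝔸ˣ}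
    (hP : ∀ (x : Site d) (μ ν : Fin d), μ ≠ ν → ‖plaqF V μ ν x - 1‖ < ε₀ / ((L : ℝ) ^ k) ^ 2)
    (hJ : ∀ (x : Site d) (μ : Fin d), ‖covDiv (((L : ℝ) ^ k)⁻¹) V μ x‖ < ε₀ / ((L : ℝ) ^ k) ^ 2) :
    CondAt L (((L : ℝ) ^ k)⁻¹) ε₀ k (Set.univ : Set (Site d)) V := by
  refine ⟨fun x μ ν hμν _ => ?_, fun x μ _ => ?_⟩
  · rw [thr_plaq_eq]; exact hP x μ ν hμν
  · rw [thr_cur_eq hL]; exact hJ x μ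

/-- `‖η·D^{η*}_{U,ν}F(x)‖`: the norm of one backward covariant derivative is `|η|⁻¹` times the norm of the transported
difference. [folklore] -/
theorem norm_covDeriv_eq (η : ℝ) (V : Site d → Fin d → 𝔸ˣ) (ν : Fin d) (F : Site d → 𝔸) (x : Site d) :
    ‖covDeriv η V ν F x‖ = |η|⁻¹ * ‖conjR (V (x - e ν) ν)⁻¹ (F (x - e ν)) - F x‖ := by
  unfold covDeriv
  rw [norm_smul, norm_inv, Real.norm_eq_abs]

/-- **THE PLANE COUNT**: if every transported difference of plaquette variables entering `(D^{η*}_U ∂U)_μ(x)` is `≤ t`,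
then `‖covDiv η U μ x‖ ≤ |η|⁻¹·(d − 1)·t` (`μ` planes `(ν, μ)`, `ν < μ`, and `d − 1 − μ` planes `(μ, ν)`, `ν > μ`). [folklore] -/
theorem norm_covDiv_le (η : ℝ) (V : Site d → Fin d → 𝔸ˣ) (μ : Fin d) (x : Site d) {t : ℝ}
    (h₁ : ∀ ν : Fin d, ν < μ → ‖conjR (V (x - e ν) ν)⁻¹ (plaqF V ν μ (x - e ν)) - plaqF V ν μ x‖ ≤ t)
    (h₂ : ∀ ν : Fin d, μ < ν → ‖conjR (V (x - e ν) ν)⁻¹ (plaqF V μ ν (x - e ν)) - plaqF V μ ν x‖ ≤ t) :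
    ‖covDiv η V μ x‖ ≤ |η|⁻¹ * (((d : ℝ) - 1) * t) := by
  unfold covDiv
  have hA : ‖∑ ν ∈ Iio μ, covDeriv η V ν (plaqF V ν μ) x‖ ≤ (Iio μ).card • (|η|⁻¹ * t) := by
    refine (norm_sum_le _ _).trans (sum_le_card_nsmul _ _ _ fun ν hν => ?_)
    rw [norm_covDeriv_eq]
    exact mul_le_mul_of_nonneg_left (h₁ ν (mem_Iio.mp hν)) (by positivity)
  have hB : ‖∑ ν ∈ Ioi μ, covDeriv η V ν (plaqF V μ ν) x‖ ≤ (Ioi μ).card • (|η|⁻¹ * t) := by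
    refine (norm_sum_le _ _).trans (sum_le_card_nsmul _ _ _ fun ν hν => ?_)
    rw [norm_covDeriv_eq]
    exact mul_le_mul_of_nonneg_left (h₂ ν (mem_Ioi.mp hν)) (by positivity)
  have hcount : (((Iio μ).card : ℕ) : ℝ) + (((Ioi μ).card : ℕ) : ℝ) = (d : ℝ) - 1 := by
    rw [Fin.card_Iio, Fin.card_Ioi]
    have hμ : (μ : ℕ) + 1 ≤ d := μ.isLt
    rw [Nat.cast_sub (show (μ : ℕ) ≤ d - 1 by omega), Nat.cast_sub (show 1 ≤ d by omega)]
    push_cast; ring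
  calc ‖∑ ν ∈ Iio μ, covDeriv η V ν (plaqF V ν μ) x - ∑ ν ∈ Ioi μ, covDeriv η V ν (plaqF V μ ν) x‖
      ≤ ‖∑ ν ∈ Iio μ, covDeriv η V ν (plaqF V ν μ) x‖ + ‖∑ ν ∈ Ioi μ, covDeriv η V ν (plaqF V μ ν) x‖ :=
        norm_sub_le _ _
    _ ≤ (Iio μ).card • (|η|⁻¹ * t) + (Ioi μ).card • (|η|⁻¹ * t) := add_le_add hA hB
    _ = |η|⁻¹ * (((d : ℝ) - 1) * t) := by rw [nsmul_eq_mul, nsmul_eq_mul, ← add_mul, hcount]; ring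

end Generic

/-! ## §3 (6) ⊆ the small-field class -/

section Matrices

variable {n : Type*} [Fintype n] [DecidableEq n]

/-- `plaqF` is the tree's fine plaquette variable `fhol` read as a matrix (definitional). [folklore] -/
theorem plaqF_eq_fhol (U : Site d → Fin d → (Matrix n n ℂ)ˣ) {μ ν : Fin d} (h : μ < ν) (x : Site d) :
    plaqF U μ ν x = ((fhol U (x, ⟨(μ, ν), h⟩) : (Matrix n n ℂ)ˣ) : Matrix n n ℂ) := rfl

/-- `R(u)` of B8 is the tree's `Ad_u` (definitional). [folklore] -/
theorem conjR_eq_Ad (u : (Matrix n n ℂ)ˣ) (X : Matrix n n ℂ) : conjR u X = Ad u X := rfl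

variable (d) in
/-- **`ClassSix ⊆ sfClass`** with the same radius letter: (1.7) at the binding level IS the small-field condition of
radius `ε₀/(L^k)²` (strict versus non-strict). [folklore] -/
theorem classSix_subset_sfClass (L N : ℕ) (ε₀ : ℝ) (k : ℕ) :
    ClassSix d L N ε₀ k ⊆ sfClass (n := n) d L N ε₀ k := by
  rintro U ⟨hu, hp, hA⟩
  refine ⟨hu, hp, fun x κ κ' hne => ?_⟩
  have h := (condAt_of_inAk_univ hA).1 x κ κ' hne (plaqTouches_univ x κ κ')
  rw [thr_plaq_eq] at h
  exact h.le

/-! ## §4 The crude route: small plaquettes alone, and the level dependence it forces -/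

variable [Nonempty n]

/-- ONE TRANSPORTED DIFFERENCE AGAINST SMALL PLAQUETTES: `‖R(u⁻¹)P′ − P‖ ≤ ‖P′ − 1‖ + ‖P − 1‖ ≤ 2a` for unitary `u` and
two plaquette variables within `a` of `1`. [folklore] -/
theorem norm_transDiff_le_of_smallField {U : Site d → Fin d → (Matrix n n ℂ)ˣ} (hU : IsUnitaryCfg U) {a : ℝ}
    (hS : SmallField U a) (x : Site d) (ν : Fin d) {μ κ : Fin d} (hμκ : μ ≠ κ) :
    ‖conjR (U (x - e ν) ν)⁻¹ (plaqF U μ κ (x - e ν)) - plaqF U μ κ x‖ ≤ 2 * a := by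
  have hu1 : (U (x - e ν) ν)⁻¹ ∈ U1 (Matrix n n ℂ) := mem_U1_of_unitary ((unitaryUnits _).inv_mem (hU _ _))
  have e1 : conjR (U (x - e ν) ν)⁻¹ (plaqF U μ κ (x - e ν)) - plaqF U μ κ x
      = conjR (U (x - e ν) ν)⁻¹ (plaqF U μ κ (x - e ν) - 1) - (plaqF U μ κ x - 1) := by
    rw [conjR_sub, conjR_one]; abel
  rw [e1]
  have h1 : ‖plaqF U μ κ (x - e ν) - 1‖ ≤ a := hS (x - e ν) μ κ hμκ
  have h2 : ‖plaqF U μ κ x - 1‖ ≤ a := hS x μ κ hμκ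
  calc ‖conjR (U (x - e ν) ν)⁻¹ (plaqF U μ κ (x - e ν) - 1) - (plaqF U μ κ x - 1)‖
      ≤ ‖conjR (U (x - e ν) ν)⁻¹ (plaqF U μ κ (x - e ν) - 1)‖ + ‖plaqF U μ κ x - 1‖ := norm_sub_le _ _
    _ ≤ a + a := by rw [norm_conjR hu1]; exact add_le_add h1 h2
    _ = 2 * a := by ring

/-- **THE CRUDE CURRENT BOUND** (k-free in `a`): unitary `U`, `SmallField U a` ⇒
`‖covDiv η U μ x‖ ≤ |η|⁻¹·(d−1)·2a` for every bond. [folklore] -/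
theorem norm_covDiv_le_of_smallField (η : ℝ) {U : Site d → Fin d → (Matrix n n ℂ)ˣ} (hU : IsUnitaryCfg U) {a : ℝ}
    (hS : SmallField U a) (x : Site d) (μ : Fin d) :
    ‖covDiv η U μ x‖ ≤ |η|⁻¹ * (((d : ℝ) - 1) * (2 * a)) :=
  norm_covDiv_le η U μ x (fun ν hν => norm_transDiff_le_of_smallField hU hS x ν hν.ne)
    (fun ν hν => norm_transDiff_le_of_smallField hU hS x ν hν.ne)

/-- **THE LEVEL DEPENDENCE THE CRUDE ROUTE FORCES** (the located NON-closure of D-s3-1 by inclusion): from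
`U ∈ sfClass ε′ k` ALONE one gets `U ∈ ClassSix ε₀ k` under `2(d−1)·ε′·L^k < ε₀` and `ε′ < ε₀` — the radius `ε′/(L^k)²`
feeds a current bound `L^k · 2(d−1) · ε′/(L^k)²`, one power of `L^k` SHORT of the threshold `ε₀/(L^k)²`.  No k-uniform
`ε′(ε₀, d)` comes out of this route (and none exists: abelian staggered witnesses, journal G-ne3leaf09g2-1 ∕ l.10705).
[folklore] -/
theorem mem_classSix_of_sfClass_level {L N : ℕ} (hL : 1 ≤ L) {ε' ε₀ : ℝ} {k : ℕ} (hε' : 0 ≤ ε')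
    (hlevel : 2 * ((d : ℝ) - 1) * ε' * (L : ℝ) ^ k < ε₀) (hεε : ε' < ε₀)
    {U : Site d → Fin d → (Matrix n n ℂ)ˣ} (hU : U ∈ sfClass (n := n) d L N ε' k) : U ∈ ClassSix d L N ε₀ k := by
  obtain ⟨hu, hp, hs⟩ := hU
  have hL1 : (1 : ℝ) ≤ L := by exact_mod_cast hL
  have hLk : (0 : ℝ) < (L : ℝ) ^ k := by positivity
  have hε₀ : 0 ≤ ε₀ := hε'.trans hεε.le
  refine ⟨hu, hp, inAk_univ_of_condAt hL (inv_pos.mpr hLk) hε₀ (condAt_top_of_bounds hL (fun x μ ν hμν => ?_)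
    (fun x μ => ?_))⟩
  · exact (hs x μ ν hμν).trans_lt (div_lt_div_of_pos_right hεε (by positivity))
  · refine (norm_covDiv_le_of_smallField _ hu hs x μ).trans_lt ?_
    rw [abs_of_pos (inv_pos.mpr hLk), inv_inv, lt_div_iff₀ (by positivity)]
    calc (L : ℝ) ^ k * (((d : ℝ) - 1) * (2 * (ε' / ((L : ℝ) ^ k) ^ 2))) * ((L : ℝ) ^ k) ^ 2
        = 2 * ((d : ℝ) - 1) * ε' * (L : ℝ) ^ k := by field_simp
      _ < ε₀ := hlevel

/-! ## §5 The current of a REGULAR configuration: the k-uniform inclusion -/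

/-- **ONE TRANSPORTED DIFFERENCE AGAINST THE COVARIANT FLUX GRADIENT**: for unitary `U` with `SmallField U a`, `a ≤ 1/4`,
the backward transported difference of the plaquette VARIABLES at `x` in direction `ν` is at most twice the forward
covariant difference of the FLUXES at `x − e_ν`:
`‖R(u⁻¹)U(∂p(x−e_ν)) − U(∂p(x))‖ = ‖e^{F(x−e_ν)} − e^{Ad_u F(x)}‖ ≤ 2·‖covGrad U (flux U) (x−e_ν) ν π‖`, `u = U(x−e_ν, ν)`
(`exp` is 2-Lipschitz on the ball `‖·‖ ≤ 1/2`; transport by a unitary is an isometry). [folklore] -/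
theorem norm_transDiff_le_of_covGrad {U : Site d → Fin d → (Matrix n n ℂ)ˣ} (hU : IsUnitaryCfg U) {a : ℝ}
    (hS : SmallField U a) (ha : a ≤ 1 / 4) (x : Site d) (ν : Fin d) (π : T4AveragingDeficitWall.Plane d) :
    ‖Ad (U (x - e ν) ν)⁻¹ ((fhol U (x - e ν, π) : (Matrix n n ℂ)ˣ) : Matrix n n ℂ)
        - ((fhol U (x, π) : (Matrix n n ℂ)ˣ) : Matrix n n ℂ)‖
      ≤ 2 * ‖covGrad U (flux U) (x - e ν) ν π‖ := by
  letI : NormedAlgebra ℚ (Matrix n n ℂ) := NormedAlgebra.restrictScalars ℚ ℂ (Matrix n n ℂ)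
  set u : (Matrix n n ℂ)ˣ := U (x - e ν) ν with hudef
  set P : Matrix n n ℂ := ((fhol U (x, π) : (Matrix n n ℂ)ˣ) : Matrix n n ℂ) with hPdef
  set P' : Matrix n n ℂ := ((fhol U (x - e ν, π) : (Matrix n n ℂ)ˣ) : Matrix n n ℂ) with hP'def
  have hu : u ∈ unitaryUnits (Matrix n n ℂ) := hU _ _
  have hui : u⁻¹ ∈ unitaryUnits (Matrix n n ℂ) := (unitaryUnits _).inv_mem hu
  have hP : ‖P - 1‖ ≤ a := norm_fhol_sub_one_le_of_smallField hS (x, π)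
  have hP' : ‖P' - 1‖ ≤ a := norm_fhol_sub_one_le_of_smallField hS (x - e ν, π)
  have hP1 : ‖P - 1‖ < 1 := lt_of_le_of_lt (hP.trans ha) (by norm_num)
  have hP'1 : ‖P' - 1‖ < 1 := lt_of_le_of_lt (hP'.trans ha) (by norm_num)
  -- `Ad_{u⁻¹} P′ − P = Ad_{u⁻¹} (P′ − Ad_u P)`
  have e1 : Ad u⁻¹ P' - P = Ad u⁻¹ (P' - Ad u P) := by
    rw [T4AveragingDeficitNonAbelian.Ad_sub, ← T4AveragingDeficitNonAbelian.Ad_mul, inv_mul_cancel]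
    simp [Ad]
  rw [e1, norm_Ad_of_unitary hui]
  -- the covariant flux gradient at `x − e_ν` is `Ad_u log P − log P′`
  have hx : x - e ν + e ν = x := sub_add_cancel x (e ν)
  have hcov : covGrad U (flux U) (x - e ν) ν π = Ad u (mlog P) - mlog P' := by
    simp only [covGrad, flux, hx, hudef, hPdef, hP'def]
  have eP : exp (mlog P) = P := exp_mlog hP1
  have eP' : exp (mlog P') = P' := exp_mlog hP'1
  have hAd : Ad u P = exp (Ad u (mlog P)) := by
    conv_lhs => rw [← eP]
    unfold Ad
    rw [Matrix.exp_units_conj]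
  rw [hAd, ← norm_neg, neg_sub]
  conv_lhs => rw [← eP']
  have h1 := Literature.Analysis.Complex.norm_exp_sub_exp_le (Ad u (mlog P)) (mlog P')
  have hn1 : ‖Ad u (mlog P)‖ ≤ 1 / 2 := by
    rw [norm_Ad_of_unitary hu]; exact (norm_mlog_le_two_mul (hP.trans (by linarith))).trans (by linarith)
  have hn2 : ‖mlog P'‖ ≤ 1 / 2 := (norm_mlog_le_two_mul (hP'.trans (by linarith))).trans (by linarith)
  have hmax : Real.exp (max ‖Ad u (mlog P)‖ ‖mlog P'‖) ≤ 2 := by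
    have h2 : Real.exp (1 / 2) ≤ 2 := by
      have := Real.exp_one_lt_d9
      have h3 : Real.exp (1 / 2) * Real.exp (1 / 2) = Real.exp 1 := by rw [← Real.exp_add]; norm_num
      nlinarith [Real.exp_pos (1 / 2 : ℝ)]
    exact (Real.exp_le_exp.mpr (max_le hn1 hn2)).trans h2
  calc ‖exp (Ad u (mlog P)) - exp (mlog P')‖
      ≤ ‖Ad u (mlog P) - mlog P'‖ * Real.exp (max ‖Ad u (mlog P)‖ ‖mlog P'‖) := h1
    _ ≤ ‖Ad u (mlog P) - mlog P'‖ * 2 := by gcongr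
    _ = 2 * ‖covGrad U (flux U) (x - e ν) ν π‖ := by rw [hcov]; ring

/-- **THE CURRENT OF A REGULAR CONFIGURATION**: unitary `U`, `SmallField U a`, `a ≤ 1/4`, covariant flux gradients
`≤ g` at every bond and plane ⇒ `‖covDiv η U μ x‖ ≤ |η|⁻¹·(d−1)·2g`. [folklore] -/
theorem norm_covDiv_le_of_covGrad (η : ℝ) {U : Site d → Fin d → (Matrix n n ℂ)ˣ} (hU : IsUnitaryCfg U) {a g : ℝ}
    (hS : SmallField U a) (ha : a ≤ 1 / 4)
    (hg : ∀ (y : Site d) (κ : Fin d) (π : T4AveragingDeficitWall.Plane d), ‖covGrad U (flux U) y κ π‖ ≤ g)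
    (x : Site d) (μ : Fin d) : ‖covDiv η U μ x‖ ≤ |η|⁻¹ * (((d : ℝ) - 1) * (2 * g)) := by
  refine norm_covDiv_le η U μ x (fun ν hν => ?_) (fun ν hν => ?_)
  · rw [conjR_eq_Ad, plaqF_eq_fhol U hν, plaqF_eq_fhol U hν]
    exact (norm_transDiff_le_of_covGrad hU hS ha x ν ⟨(ν, μ), hν⟩).trans (by linarith [hg (x - e ν) ν ⟨(ν, μ), hν⟩])
  · rw [conjR_eq_Ad, plaqF_eq_fhol U hν, plaqF_eq_fhol U hν]
    exact (norm_transDiff_le_of_covGrad hU hS ha x ν ⟨(μ, ν), hν⟩).trans (by linarith [hg (x - e ν) ν ⟨(μ, ν), hν⟩])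

/-- **THE k-UNIFORM INCLUSION `{regular small fields} ⊆ (6)`**: `RegularSup d L N b c k U` (plaquettes within `b/(L^k)²`
of `1`, covariant flux gradients `≤ c/(L^k)³` — exactly the data `SmoothRefine` hands to the sandwich's refined
competitor), `b ≤ 1/4`, `b < ε₀` and `2(d−1)·c < ε₀` ⇒ `U ∈ ClassSix d L N ε₀ k`, for EVERY level `k` with the SAME `ε₀`:
the current is `L^k · (d−1) · 2c/(L^k)³ = 2(d−1)c/(L^k)²`, below the threshold `ε₀/(L^k)²`. [folklore] -/
theorem mem_classSix_of_regularSup {L N : ℕ} (hL : 1 ≤ L) {b c ε₀ : ℝ} {k : ℕ} (hb : 0 ≤ b) (hb4 : b ≤ 1 / 4)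
    (hbε : b < ε₀) (hcε : 2 * ((d : ℝ) - 1) * c < ε₀)
    {U : Site d → Fin d → (Matrix n n ℂ)ˣ} (hreg : RegularSup d L N b c k U) : U ∈ ClassSix d L N ε₀ k := by
  have hL1 : (1 : ℝ) ≤ L := by exact_mod_cast hL
  have hLk : (0 : ℝ) < (L : ℝ) ^ k := by positivity
  have hs1 : (1 : ℝ) ≤ ((L : ℝ) ^ k) ^ 2 := one_le_pow₀ (one_le_pow₀ hL1)
  have ha4 : b / ((L : ℝ) ^ k) ^ 2 ≤ 1 / 4 := (div_le_self hb hs1).trans hb4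
  have hε₀ : 0 ≤ ε₀ := hb.trans hbε.le
  refine ⟨hreg.unitary, hreg.periodic, inAk_univ_of_condAt hL (inv_pos.mpr hLk) hε₀
    (condAt_top_of_bounds hL (fun x μ ν hμν => ?_) (fun x μ => ?_))⟩
  · exact (hreg.small x μ ν hμν).trans_lt (div_lt_div_of_pos_right hbε (by positivity))
  · refine (norm_covDiv_le_of_covGrad _ hreg.unitary hreg.small ha4 hreg.grad x μ).trans_lt ?_
    rw [abs_of_pos (inv_pos.mpr hLk), inv_inv, lt_div_iff₀ (by positivity)]
    calc (L : ℝ) ^ k * (((d : ℝ) - 1) * (2 * (c / ((L : ℝ) ^ k) ^ 3))) * ((L : ℝ) ^ k) ^ 2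
        = 2 * ((d : ℝ) - 1) * c := by field_simp
      _ < ε₀ := hcε

/-- The family form for `MinimalActionClassAgnostic.smoothRefine_of_subset`'s successor: every configuration with
sup-form regularity `(b′, c′)` at ANY level lies in `ClassSix ε₀` at that level (`b′ ≤ 1/4`, `b′ < ε₀`, `2(d−1)c′ < ε₀`) —
the refined competitor's membership in (6), k-uniformly.  (The AVERAGED competitor's membership is NOT supplied here:
it is the skeleton's risk (r3), a B8 Prop. 3-TYPE transport of the current under block averaging.) [folklore] -/
theorem regularSup_subset_classSix {L N : ℕ} (hL : 1 ≤ L) {b' c' ε₀ : ℝ} (hb : 0 ≤ b') (hb4 : b' ≤ 1 / 4)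
    (hbε : b' < ε₀) (hcε : 2 * ((d : ℝ) - 1) * c' < ε₀) :
    ∀ (j : ℕ) (U : Site d → Fin d → (Matrix n n ℂ)ˣ), RegularSup d L N b' c' j U → U ∈ ClassSix d L N ε₀ j :=
  fun _ _ hreg => mem_classSix_of_regularSup hL hb hb4 hbε hcε hreg

/-! ## §6 Non-vacuity -/

/-- The flat configuration (all plaquette variables `1`, all currents `0`) lies in `ClassSix ε₀ k` for every `ε₀ > 0`,
`L ≥ 1`, `N`, `k`. [folklore] -/
theorem flatCfg_mem_classSix {L : ℕ} (hL : 1 ≤ L) (N : ℕ) {ε₀ : ℝ} (hε : 0 < ε₀) (k : ℕ) :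
    (flatCfg : Site d → Fin d → (Matrix n n ℂ)ˣ) ∈ ClassSix d L N ε₀ k :=
  mem_classSix_of_regularSup hL le_rfl (by norm_num) hε (by simpa using hε) (regularSup_flatCfg L N k le_rfl le_rfl)

variable (d) in
/-- `ClassSix ε₀ k` is non-empty for `ε₀ > 0`. [folklore] -/
theorem classSix_nonempty {L : ℕ} (hL : 1 ≤ L) (N : ℕ) {ε₀ : ℝ} (hε : 0 < ε₀) (k : ℕ) :
    (ClassSix d L N ε₀ k : Set (Site d → Fin d → (Matrix n n ℂ)ˣ)).Nonempty :=
  ⟨flatCfg, flatCfg_mem_classSix hL N hε k⟩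

end Matrices

end

end Summit.QuantumFields.BalabanUV.T4Continuum.MinimalActionClassSix
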